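import Mathlib.Algebra.QuadraticDiscriminant
import Mathlib.Analysis.SpecificLimits.Basic
import Mathlib.Data.Nat.Choose.Sum
import Mathlib.Algebra.BigOperators.Fin
import HarnessLib

/-!
# Completely monotone sequences from two positive semidefinite Hankel forms
# (crux `ExistsScaleCovariantLimit`, stmt-CriticalPhenomena-1981, line `folded-current-repulsion`, F2 record — abstract core)

The finitary half of Hausdorff–Stieltjes moment theory used by
`…FoldedCurrentAxisCompleteMonotonicity` (the Ising instance): for a BOUNDED real sequence `g` whose
two Hankel forms `H₀[c] = Σ_{a,b} c_a c_b g(a+b)` and `H₁[c] = Σ_{a,b} c_a c_b g(a+b+1)` are positive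
semidefinite (for the critical axis two-point function these are site- and bond-mirror reflection
positivity),

`0 ≤ Σ_{j=0}^{k} (-1)^j (k choose j) g(n+j)`   for all `k, n`   (`completelyMonotone_of_hankel_psd`),

i.e. `g` is completely monotone (Hausdorff's condition). No spectral measure is constructed:

1. the offset forms `H_r[c] = Σ c_a c_b g(a+b+r)` are nonnegative (`form_nonneg`: even `r` is `H₀`
   of a shifted vector, odd `r` is `H₁` of one), LOG-CONVEX in `r` (`form_sq_le`: discriminant of the
   nonnegative quadratic `t ↦ H_r[c + t·shift c]`, i.e. Cauchy–Schwarz for `H_r`) and bounded; a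
   nonnegative bounded log-convex sequence is nonincreasing (`le_of_logConvex_bdd`), whence the
   domination **`H₁[c] ≤ H₀[c]`** (`form_one_le_form_zero`) — the operator inequality `T ≤ 1` for the
   transfer operator in the GNS space of `H₀`;
2. so the class {bounded, `H₀ ⪰ 0`, `H₁ ⪰ 0`} is stable under the shift and under the backward
   difference `g ↦ g − g(·+1)` (`shift_closure`, `diff_closure`, `iterate_diff_closure`); members are
   nonnegative (diagonal entries, `nonneg_of_hankel_psd`), and the iterated difference is the
   alternating binomial sum (`iterate_diff_eq_sum`).

References: C. Berg, J. P. R. Christensen, P. Ressel, *Harmonic Analysis on Semigroups*, GTM 100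
(Springer 1984), Ch. 4 §6 (bounded positive definite functions on `(ℕ,+)` with positive shift are the
Hausdorff moment sequences) [BergChristensenRessel1984]; D. V. Widder, *The Laplace Transform*
(Princeton 1941), Ch. III §4, Ch. IV §2 [Widder1941]; the Cauchy–Schwarz/log-convexity step is the one
of M. Aizenman, H. Duminil-Copin, Ann. of Math. 194 (2021), arXiv:1912.07973, Prop. 5.3 (5.17) and §5.5
[AizenmanDuminilCopinAnnals2021]. Mathlib: `discrim_le_zero`, `Finset.sum_range_succ'`,
`tendsto_pow_atTop_atTop_of_one_lt`, `Nat.choose_succ_succ'`.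
-/

noncomputable section

open Finset
open scoped BigOperators

namespace Summit.CriticalPhenomena.Ising3DConformalLimit.Cruxes.ExistsScaleCovariantLimit.FoldedCurrentRepulsion

namespace HankelMoment

/-! ### 1. Hankel forms at all offsets are nonnegative -/

/-- The Hankel form at offset `r + 2` of `c` (length `m`) is the Hankel form at offset `r` of the
shifted vector `(0, c₀, …, c_{m-1})` (length `m + 1`). [folklore] -/
theorem form_shift (g : ℕ → ℝ) (r m : ℕ) (c : ℕ → ℝ) :
    ∑ a ∈ range (m + 1), ∑ b ∈ range (m + 1),
        (if a = 0 then 0 else c (a - 1)) * (if b = 0 then 0 else c (b - 1)) * g (a + b + r) =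
      ∑ a ∈ range m, ∑ b ∈ range m, c a * c b * g (a + b + (r + 2)) := by
  rw [sum_range_succ']
  simp only [if_true, zero_mul, sum_const_zero, add_zero, Nat.succ_ne_zero, if_false,
    Nat.add_sub_cancel]
  refine sum_congr rfl fun a _ => ?_
  rw [sum_range_succ']
  simp only [if_true, mul_zero, zero_mul, add_zero, Nat.succ_ne_zero, if_false, Nat.add_sub_cancel]
  refine sum_congr rfl fun b _ => ?_
  congr 2
  omega

/-- **All offset Hankel forms are nonnegative**: if `H₀ ⪰ 0` and `H₁ ⪰ 0` then
`Σ_{a,b<m} c_a c_b g(a+b+r) ≥ 0` for every `r` (shift the vector `⌊r/2⌋` times).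
[cite: BergChristensenRessel1984, Ch. 4 §6] -/
theorem form_nonneg {g : ℕ → ℝ}
    (h0 : ∀ (m : ℕ) (c : ℕ → ℝ), 0 ≤ ∑ a ∈ range m, ∑ b ∈ range m, c a * c b * g (a + b))
    (h1 : ∀ (m : ℕ) (c : ℕ → ℝ), 0 ≤ ∑ a ∈ range m, ∑ b ∈ range m, c a * c b * g (a + b + 1)) :
    ∀ (r m : ℕ) (c : ℕ → ℝ), 0 ≤ ∑ a ∈ range m, ∑ b ∈ range m, c a * c b * g (a + b + r)
  | 0, m, c => by simpa using h0 m c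
  | 1, m, c => h1 m c
  | r + 2, m, c => by
    rw [← form_shift g r m c]
    exact form_nonneg h0 h1 r (m + 1) _

/-! ### 2. Log-convexity in the offset and the domination `H₁ ≤ H₀` -/

/-- **Log-convexity of the offset Hankel forms**: for a vector `c` supported in `[0, m)`,
`(Σ c_a c_b g(a+b+r+1))² ≤ (Σ c_a c_b g(a+b+r)) · (Σ c_a c_b g(a+b+r+2))` — the discriminant of the
nonnegative quadratic `t ↦ H_r[c + t·shift c]` (Cauchy–Schwarz for the positive semidefinite form
`H_r`). [cite: AizenmanDuminilCopinAnnals2021, arXiv:1912.07973 Prop. 5.3 (5.17), §5.5] -/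
theorem form_sq_le {g : ℕ → ℝ}
    (h0 : ∀ (m : ℕ) (c : ℕ → ℝ), 0 ≤ ∑ a ∈ range m, ∑ b ∈ range m, c a * c b * g (a + b))
    (h1 : ∀ (m : ℕ) (c : ℕ → ℝ), 0 ≤ ∑ a ∈ range m, ∑ b ∈ range m, c a * c b * g (a + b + 1))
    (r m : ℕ) (c : ℕ → ℝ) (hc : ∀ a, m ≤ a → c a = 0) :
    (∑ a ∈ range m, ∑ b ∈ range m, c a * c b * g (a + b + (r + 1))) ^ 2 ≤
      (∑ a ∈ range m, ∑ b ∈ range m, c a * c b * g (a + b + r)) *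
        (∑ a ∈ range m, ∑ b ∈ range m, c a * c b * g (a + b + (r + 2))) := by
  -- the shifted vector and the three coefficients of the quadratic
  set s : ℕ → ℝ := fun a => if a = 0 then 0 else c (a - 1) with hs
  set A : ℝ := ∑ a ∈ range m, ∑ b ∈ range m, c a * c b * g (a + b + r) with hA
  set X : ℝ := ∑ a ∈ range m, ∑ b ∈ range m, c a * c b * g (a + b + (r + 1)) with hX
  set B : ℝ := ∑ a ∈ range m, ∑ b ∈ range m, c a * c b * g (a + b + (r + 2)) with hB
  -- sums over `range (m+1)` of `c`-terms reduce to `range m` since `c m = 0`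
  have hcm : c m = 0 := hc m le_rfl
  have hA' : ∑ a ∈ range (m + 1), ∑ b ∈ range (m + 1), c a * c b * g (a + b + r) = A := by
    rw [sum_range_succ, hcm]
    simp only [zero_mul, sum_const_zero, add_zero]
    refine sum_congr rfl fun a _ => ?_
    rw [sum_range_succ, hcm]
    simp
  have hX' : ∑ a ∈ range (m + 1), ∑ b ∈ range (m + 1), c a * s b * g (a + b + r) = X := by
    rw [sum_range_succ, hcm]
    simp only [zero_mul, sum_const_zero, add_zero]
    refine sum_congr rfl fun a _ => ?_
    rw [sum_range_succ']
    simp only [hs, if_true, mul_zero, zero_mul, add_zero, Nat.succ_ne_zero, if_false,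
      Nat.add_sub_cancel]
    refine sum_congr rfl fun b _ => ?_
    congr 2
    omega
  have hX'' : ∑ a ∈ range (m + 1), ∑ b ∈ range (m + 1), s a * c b * g (a + b + r) = X := by
    rw [sum_comm, ← hX']
    refine sum_congr rfl fun a _ => sum_congr rfl fun b _ => ?_
    rw [add_comm b a]
    ring
  have hB' : ∑ a ∈ range (m + 1), ∑ b ∈ range (m + 1), s a * s b * g (a + b + r) = B := by
    rw [hB, ← form_shift g r m c]
  -- the quadratic `t ↦ H_r[c + t s] = B t² + 2X t + A ≥ 0`
  have hquad : ∀ t : ℝ, 0 ≤ B * (t * t) + 2 * X * t + A := by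
    intro t
    have h := form_nonneg h0 h1 r (m + 1) (fun a => c a + t * s a)
    have hexp : ∑ a ∈ range (m + 1), ∑ b ∈ range (m + 1),
        (c a + t * s a) * (c b + t * s b) * g (a + b + r) =
        (∑ a ∈ range (m + 1), ∑ b ∈ range (m + 1), c a * c b * g (a + b + r)) +
        t * (∑ a ∈ range (m + 1), ∑ b ∈ range (m + 1), c a * s b * g (a + b + r)) +
        t * (∑ a ∈ range (m + 1), ∑ b ∈ range (m + 1), s a * c b * g (a + b + r)) +
        t * t * (∑ a ∈ range (m + 1), ∑ b ∈ range (m + 1), s a * s b * g (a + b + r)) := by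
      simp only [mul_sum, ← sum_add_distrib]
      refine sum_congr rfl fun a _ => sum_congr rfl fun b _ => ?_
      ring
    rw [hexp, hA', hX', hX'', hB'] at h
    nlinarith [h]
  have hdisc := discrim_le_zero hquad
  rw [discrim] at hdisc
  nlinarith [hdisc]

/-- **A nonnegative, bounded, log-convex sequence is nonincreasing at the start**: `u₁ ≤ u₀`
(a ratio `u₁/u₀ > 1` would propagate and force geometric growth). [folklore] -/
theorem le_of_logConvex_bdd (u : ℕ → ℝ) (hpos : ∀ r, 0 ≤ u r)
    (hlc : ∀ r, u (r + 1) ^ 2 ≤ u r * u (r + 2)) (hbdd : ∃ M : ℝ, ∀ r, u r ≤ M) :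
    u 1 ≤ u 0 := by
  by_contra hlt
  push Not at hlt
  have hu1 : 0 < u 1 := lt_of_le_of_lt (hpos 0) hlt
  have hu0 : 0 < u 0 := by
    rcases (hpos 0).lt_or_eq with h | h
    · exact h
    · exfalso
      have := hlc 0
      rw [← h, zero_mul] at this
      nlinarith
  set ρ : ℝ := u 1 / u 0 with hρ
  have hρ1 : 1 < ρ := by rw [hρ, lt_div_iff₀ hu0]; linarith
  have hρ0 : 0 < ρ := by linarith
  -- geometric growth
  have hstep : ∀ r, 0 < u r ∧ ρ * u r ≤ u (r + 1) := by
    intro r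
    induction r with
    | zero => exact ⟨hu0, by rw [hρ, div_mul_cancel₀ _ hu0.ne']⟩
    | succ r ih =>
      obtain ⟨hr, hrr⟩ := ih
      have hr1 : 0 < u (r + 1) := lt_of_lt_of_le (mul_pos hρ0 hr) hrr
      refine ⟨hr1, ?_⟩
      -- `u(r+2) ≥ u(r+1)²/u(r) ≥ ρ u(r+1)`
      have h2 := hlc r
      have : ρ * u (r + 1) * u r ≤ u (r + 1) ^ 2 := by nlinarith
      by_contra hcon
      push Not at hcon
      have : u r * u (r + 2) < u r * (ρ * u (r + 1)) := by
        exact mul_lt_mul_of_pos_left hcon hr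
      nlinarith
  have hgrow : ∀ r, ρ ^ r * u 0 ≤ u r := by
    intro r
    induction r with
    | zero => simp
    | succ r ih =>
      calc ρ ^ (r + 1) * u 0 = ρ * (ρ ^ r * u 0) := by ring
        _ ≤ ρ * u r := mul_le_mul_of_nonneg_left ih hρ0.le
        _ ≤ u (r + 1) := (hstep r).2
  obtain ⟨M, hM⟩ := hbdd
  have htop : Filter.Tendsto (fun r : ℕ => ρ ^ r * u 0) Filter.atTop Filter.atTop :=
    (tendsto_pow_atTop_atTop_of_one_lt hρ1).atTop_mul_const hu0
  obtain ⟨r, hr⟩ := (htop.eventually_gt_atTop M).exists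
  exact absurd ((hgrow r).trans (hM r)) (not_le.2 hr)

/-- **Domination `H₁ ≤ H₀`**: for a BOUNDED sequence with both Hankel forms positive semidefinite,
`Σ_{a,b<m} c_a c_b g(a+b+1) ≤ Σ_{a,b<m} c_a c_b g(a+b)` for every coefficient vector — the operator
inequality `T ≤ 1` for the transfer operator in the GNS space of the form `H₀`, obtained here from
log-convexity in the offset plus boundedness. [cite: BergChristensenRessel1984, Ch. 4 §6] -/
theorem form_one_le_form_zero {g : ℕ → ℝ} (hb : ∃ M : ℝ, ∀ n, |g n| ≤ M)
    (h0 : ∀ (m : ℕ) (c : ℕ → ℝ), 0 ≤ ∑ a ∈ range m, ∑ b ∈ range m, c a * c b * g (a + b))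
    (h1 : ∀ (m : ℕ) (c : ℕ → ℝ), 0 ≤ ∑ a ∈ range m, ∑ b ∈ range m, c a * c b * g (a + b + 1))
    (m : ℕ) (c : ℕ → ℝ) :
    ∑ a ∈ range m, ∑ b ∈ range m, c a * c b * g (a + b + 1) ≤
      ∑ a ∈ range m, ∑ b ∈ range m, c a * c b * g (a + b) := by
  -- truncate `c` to `[0, m)` (the sums only see these values)
  set c' : ℕ → ℝ := fun a => if a < m then c a else 0 with hc'
  have hc'supp : ∀ a, m ≤ a → c' a = 0 := fun a ha => by
    rw [hc']; dsimp only; rw [if_neg (not_lt.2 ha)]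
  have heq : ∀ r, ∑ a ∈ range m, ∑ b ∈ range m, c a * c b * g (a + b + r) =
      ∑ a ∈ range m, ∑ b ∈ range m, c' a * c' b * g (a + b + r) := by
    intro r
    refine sum_congr rfl fun a ha => sum_congr rfl fun b hb => ?_
    rw [hc']; dsimp only
    rw [if_pos (mem_range.1 ha), if_pos (mem_range.1 hb)]
  have h0' : ∑ a ∈ range m, ∑ b ∈ range m, c a * c b * g (a + b) =
      ∑ a ∈ range m, ∑ b ∈ range m, c' a * c' b * g (a + b + 0) := by
    simpa using heq 0
  rw [heq 1, h0']
  -- the sequence `u r = H_r[c']`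
  set u : ℕ → ℝ := fun r => ∑ a ∈ range m, ∑ b ∈ range m, c' a * c' b * g (a + b + r) with hu
  change u 1 ≤ u 0
  refine le_of_logConvex_bdd u (fun r => form_nonneg h0 h1 r m c') (fun r => ?_) ?_
  · have := form_sq_le h0 h1 r m c' hc'supp
    simpa [hu] using this
  · obtain ⟨M, hM⟩ := hb
    refine ⟨∑ a ∈ range m, ∑ b ∈ range m, |c' a| * |c' b| * M, fun r => ?_⟩
    refine sum_le_sum fun a _ => sum_le_sum fun b _ => ?_
    calc c' a * c' b * g (a + b + r) ≤ |c' a * c' b * g (a + b + r)| := le_abs_self _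
      _ = |c' a| * |c' b| * |g (a + b + r)| := by rw [abs_mul, abs_mul]
      _ ≤ |c' a| * |c' b| * M :=
          mul_le_mul_of_nonneg_left (hM _) (mul_nonneg (abs_nonneg _) (abs_nonneg _))

/-! ### 3. The class {bounded, `H₀ ⪰ 0`, `H₁ ⪰ 0`} is stable under shift and difference -/

/-- **Shift closure**: if `g` is bounded with `H₀, H₁ ⪰ 0` then so is `n ↦ g(n+1)`
(`H₀` of the shift is `H₁`; `H₁` of the shift is the offset-2 form). [folklore] -/
theorem shift_closure {g : ℕ → ℝ} (hb : ∃ M : ℝ, ∀ n, |g n| ≤ M)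
    (h0 : ∀ (m : ℕ) (c : ℕ → ℝ), 0 ≤ ∑ a ∈ range m, ∑ b ∈ range m, c a * c b * g (a + b))
    (h1 : ∀ (m : ℕ) (c : ℕ → ℝ), 0 ≤ ∑ a ∈ range m, ∑ b ∈ range m, c a * c b * g (a + b + 1)) :
    (∃ M : ℝ, ∀ n, |g (n + 1)| ≤ M) ∧
    (∀ (m : ℕ) (c : ℕ → ℝ), 0 ≤ ∑ a ∈ range m, ∑ b ∈ range m, c a * c b * g (a + b + 1)) ∧
    (∀ (m : ℕ) (c : ℕ → ℝ), 0 ≤ ∑ a ∈ range m, ∑ b ∈ range m, c a * c b * g (a + b + 1 + 1)) := by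
  refine ⟨?_, h1, fun m c => ?_⟩
  · obtain ⟨M, hM⟩ := hb
    exact ⟨M, fun n => hM _⟩
  · have := form_nonneg h0 h1 2 m c
    simpa [add_assoc] using this

/-- **Difference closure**: if `g` is bounded with `H₀, H₁ ⪰ 0` then so is the backward difference
`n ↦ g(n) − g(n+1)`: its `H₀` is `H₀ − H₁ ⪰ 0` and its `H₁` is `H₁ − H₂ ⪰ 0` (domination applied to
`g` and to its shift). [cite: BergChristensenRessel1984, Ch. 4 §6] -/
theorem diff_closure {g : ℕ → ℝ} (hb : ∃ M : ℝ, ∀ n, |g n| ≤ M)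
    (h0 : ∀ (m : ℕ) (c : ℕ → ℝ), 0 ≤ ∑ a ∈ range m, ∑ b ∈ range m, c a * c b * g (a + b))
    (h1 : ∀ (m : ℕ) (c : ℕ → ℝ), 0 ≤ ∑ a ∈ range m, ∑ b ∈ range m, c a * c b * g (a + b + 1)) :
    (∃ M : ℝ, ∀ n, |g n - g (n + 1)| ≤ M) ∧
    (∀ (m : ℕ) (c : ℕ → ℝ),
      0 ≤ ∑ a ∈ range m, ∑ b ∈ range m, c a * c b * (g (a + b) - g (a + b + 1))) ∧
    (∀ (m : ℕ) (c : ℕ → ℝ),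
      0 ≤ ∑ a ∈ range m, ∑ b ∈ range m, c a * c b * (g (a + b + 1) - g (a + b + 1 + 1))) := by
  refine ⟨?_, fun m c => ?_, fun m c => ?_⟩
  · obtain ⟨M, hM⟩ := hb
    refine ⟨M + M, fun n => ?_⟩
    calc |g n - g (n + 1)| ≤ |g n| + |g (n + 1)| := abs_sub _ _
      _ ≤ M + M := add_le_add (hM _) (hM _)
  · have h := form_one_le_form_zero hb h0 h1 m c
    have : ∑ a ∈ range m, ∑ b ∈ range m, c a * c b * (g (a + b) - g (a + b + 1)) =
        (∑ a ∈ range m, ∑ b ∈ range m, c a * c b * g (a + b)) -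
        ∑ a ∈ range m, ∑ b ∈ range m, c a * c b * g (a + b + 1) := by
      simp only [mul_sub, sum_sub_distrib]
    rw [this]
    linarith
  · obtain ⟨hb', h0', h1'⟩ := shift_closure hb h0 h1
    have h := form_one_le_form_zero (g := fun n => g (n + 1)) hb' h0' h1' m c
    have : ∑ a ∈ range m, ∑ b ∈ range m, c a * c b * (g (a + b + 1) - g (a + b + 1 + 1)) =
        (∑ a ∈ range m, ∑ b ∈ range m, c a * c b * g (a + b + 1)) -
        ∑ a ∈ range m, ∑ b ∈ range m, c a * c b * g (a + b + 1 + 1) := by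
      simp only [mul_sub, sum_sub_distrib]
    rw [this]
    linarith

/-- **Iterated differences stay in the class**: for every `k`, the `k`-th backward difference
`(1 − S)^k g` of a bounded sequence with `H₀, H₁ ⪰ 0` is bounded with `H₀, H₁ ⪰ 0`. [cite: BergChristensenRessel1984, Ch. 4 §6] -/
theorem iterate_diff_closure {g : ℕ → ℝ} (hb : ∃ M : ℝ, ∀ n, |g n| ≤ M)
    (h0 : ∀ (m : ℕ) (c : ℕ → ℝ), 0 ≤ ∑ a ∈ range m, ∑ b ∈ range m, c a * c b * g (a + b))
    (h1 : ∀ (m : ℕ) (c : ℕ → ℝ), 0 ≤ ∑ a ∈ range m, ∑ b ∈ range m, c a * c b * g (a + b + 1))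
    (k : ℕ) :
    (∃ M : ℝ, ∀ n, |((fun f : ℕ → ℝ => fun n => f n - f (n + 1))^[k] g) n| ≤ M) ∧
    (∀ (m : ℕ) (c : ℕ → ℝ), 0 ≤ ∑ a ∈ range m, ∑ b ∈ range m,
      c a * c b * ((fun f : ℕ → ℝ => fun n => f n - f (n + 1))^[k] g) (a + b)) ∧
    (∀ (m : ℕ) (c : ℕ → ℝ), 0 ≤ ∑ a ∈ range m, ∑ b ∈ range m,
      c a * c b * ((fun f : ℕ → ℝ => fun n => f n - f (n + 1))^[k] g) (a + b + 1)) := by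
  induction k with
  | zero => exact ⟨hb, h0, h1⟩
  | succ k ih =>
    obtain ⟨hbk, h0k, h1k⟩ := ih
    rw [Function.iterate_succ_apply']
    exact diff_closure hbk h0k h1k

/-- **Members of the class are nonnegative**: the values `g(2a)` and `g(2a+1)` are diagonal entries
of `H₀` and `H₁`. [folklore] -/
theorem nonneg_of_hankel_psd {g : ℕ → ℝ}
    (h0 : ∀ (m : ℕ) (c : ℕ → ℝ), 0 ≤ ∑ a ∈ range m, ∑ b ∈ range m, c a * c b * g (a + b))
    (h1 : ∀ (m : ℕ) (c : ℕ → ℝ), 0 ≤ ∑ a ∈ range m, ∑ b ∈ range m, c a * c b * g (a + b + 1))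
    (n : ℕ) : 0 ≤ g n := by
  have hdiag : ∀ (r a : ℕ), ∑ i ∈ range (a + 1), ∑ j ∈ range (a + 1),
      (if i = a then (1 : ℝ) else 0) * (if j = a then (1 : ℝ) else 0) * g (i + j + r) =
      g (a + a + r) := by
    intro r a
    have ha : a ∈ range (a + 1) := mem_range.2 (Nat.lt_succ_self a)
    rw [sum_eq_single_of_mem a ha]
    · rw [sum_eq_single_of_mem a ha]
      · simp
      · intro j _ hj
        simp [hj]
    · intro i _ hi
      simp [hi]
  obtain ⟨a, rfl | rfl⟩ := Nat.even_or_odd' n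
  · have h := h0 (a + 1) (fun i => if i = a then 1 else 0)
    have := hdiag 0 a
    simp only [add_zero] at this
    rw [this] at h
    simpa [two_mul] using h
  · have h := h1 (a + 1) (fun i => if i = a then 1 else 0)
    rw [hdiag 1 a] at h
    simpa [two_mul] using h

/-- **The iterated backward difference is the alternating binomial sum**:
`((1 − S)^k g)(n) = Σ_{j=0}^{k} (-1)^j (k choose j) g(n+j)`. [folklore] -/
theorem iterate_diff_eq_sum (g : ℕ → ℝ) (k n : ℕ) :
    ((fun f : ℕ → ℝ => fun n => f n - f (n + 1))^[k] g) n =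
      ∑ j ∈ range (k + 1), (-1 : ℝ) ^ j * (k.choose j : ℝ) * g (n + j) := by
  induction k generalizing n with
  | zero => simp
  | succ k ih =>
    rw [Function.iterate_succ_apply', ih n, ih (n + 1)]
    -- Pascal's rule, written out on the alternating sums
    have hR : ∑ j ∈ range (k + 1 + 1), (-1 : ℝ) ^ j * ((k + 1).choose j : ℝ) * g (n + j) =
        ∑ j ∈ range (k + 1), (-1 : ℝ) ^ (j + 1) * ((k + 1).choose (j + 1) : ℝ) * g (n + (j + 1)) +
          g n := by
      rw [sum_range_succ']
      simp
    have hP : ∑ j ∈ range (k + 1), (-1 : ℝ) ^ (j + 1) * ((k + 1).choose (j + 1) : ℝ) * g (n + (j + 1)) =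
        ∑ j ∈ range (k + 1), (-1 : ℝ) ^ (j + 1) * (k.choose j : ℝ) * g (n + (j + 1)) +
        ∑ j ∈ range (k + 1), (-1 : ℝ) ^ (j + 1) * (k.choose (j + 1) : ℝ) * g (n + (j + 1)) := by
      rw [← sum_add_distrib]
      refine sum_congr rfl fun j _ => ?_
      rw [Nat.choose_succ_succ', Nat.cast_add]
      ring
    have hA : ∑ j ∈ range (k + 1), (-1 : ℝ) ^ (j + 1) * (k.choose j : ℝ) * g (n + (j + 1)) =
        -∑ j ∈ range (k + 1), (-1 : ℝ) ^ j * (k.choose j : ℝ) * g (n + 1 + j) := by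
      rw [← sum_neg_distrib]
      refine sum_congr rfl fun j _ => ?_
      rw [show n + 1 + j = n + (j + 1) by omega, pow_succ]
      ring
    have hB : ∑ j ∈ range (k + 1), (-1 : ℝ) ^ (j + 1) * (k.choose (j + 1) : ℝ) * g (n + (j + 1)) =
        ∑ j ∈ range k, (-1 : ℝ) ^ (j + 1) * (k.choose (j + 1) : ℝ) * g (n + (j + 1)) := by
      rw [sum_range_succ, Nat.choose_succ_self]
      simp
    have hC : ∑ j ∈ range (k + 1), (-1 : ℝ) ^ j * (k.choose j : ℝ) * g (n + j) =
        ∑ j ∈ range k, (-1 : ℝ) ^ (j + 1) * (k.choose (j + 1) : ℝ) * g (n + (j + 1)) + g n := by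
      rw [sum_range_succ']
      simp
    linarith [hR, hP, hA, hB, hC]

/-- **COMPLETE MONOTONICITY FROM THE TWO HANKEL FORMS.** A bounded real sequence `g` whose Hankel
forms `Σ c_a c_b g(a+b)` and `Σ c_a c_b g(a+b+1)` are both positive semidefinite is completely
monotone: `Σ_{j=0}^{k} (-1)^j (k choose j) g(n+j) ≥ 0` for all `k, n` (Hausdorff's condition; with
boundedness these are exactly the moment sequences of finite measures on `[0,1]`).
[cite: BergChristensenRessel1984, Ch. 4 §6] [cite: Widder1941, Ch. III §4] -/
theorem completelyMonotone_of_hankel_psd : ∀ {g : ℕ → ℝ}, (∃ M : ℝ, ∀ n, |g n| ≤ M) → (∀ (m : ℕ) (c : ℕ → ℝ), 0 ≤ ∑ a ∈ Finset.range m, ∑ b ∈ Finset.range m, c a * c b * g (a + b)) → (∀ (m : ℕ) (c : ℕ → ℝ), 0 ≤ ∑ a ∈ Finset.range m, ∑ b ∈ Finset.range m, c a * c b * g (a + b + 1)) → ∀ (k n : ℕ), 0 ≤ ∑ j ∈ Finset.range (k + 1), (-1 : ℝ) ^ j * (k.choose j : ℝ) * g (n + j) := by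
  intro g hb h0 h1 k n
  rw [← iterate_diff_eq_sum g k n]
  obtain ⟨_, h0k, h1k⟩ := iterate_diff_closure hb h0 h1 k
  exact nonneg_of_hankel_psd h0k h1k n

/-- The same with coefficient vectors indexed by `Fin m` (the shape of the tree's RP stubs).
[cite: BergChristensenRessel1984, Ch. 4 §6] -/
theorem completelyMonotone_of_hankel_psd_fin {g : ℕ → ℝ} (hb : ∃ M : ℝ, ∀ n, |g n| ≤ M)
    (h0 : ∀ (m : ℕ) (c : Fin m → ℝ), 0 ≤ ∑ a, ∑ b, c a * c b * g (a + b))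
    (h1 : ∀ (m : ℕ) (c : Fin m → ℝ), 0 ≤ ∑ a, ∑ b, c a * c b * g (a + b + 1))
    (k n : ℕ) :
    0 ≤ ∑ j ∈ range (k + 1), (-1 : ℝ) ^ j * (k.choose j : ℝ) * g (n + j) := by
  refine completelyMonotone_of_hankel_psd hb (fun m c => ?_) (fun m c => ?_) k n
  · simp only [Finset.sum_range]
    exact h0 m (fun a => c a)
  · simp only [Finset.sum_range]
    exact h1 m (fun a => c a)

end HankelMoment

end Summit.CriticalPhenomena.Ising3DConformalLimit.Cruxes.ExistsScaleCovariantLimit.FoldedCurrentRepulsion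

end
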